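import Summits.QuantumFields.YangMills.Theorems.RationalShortRootRigidityBezoutOverSpatialField
import Summits.QuantumFields.YangMills.Theorems.RationalShortRootRigidityRootsClosedLimit
import Summits.QuantumFields.YangMills.Theorems.RationalShortRootRigidityOpenVanishing
import Summits.QuantumFields.YangMills.Theorems.RationalShortRootRigidityPlanarRestriction
import HarnessLib

/-!
# `RationalShortRootRigidity` — Step 1 assembly helper (§6 of the `stub_reduce` plan): Wick-hyperbolicity along `e₀`

Helper lemma INSIDE the paper proof of crux `stmt-QuantumFields-23124` (`F4SubCurvatureDoor.RationalShortRootRigidity`,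
LINE g15-A of planner ym-idea-3; owner's assembly plan HOME l15/STUB-PLAN-Reduce.md §6):

**Lemma** (`wickAlong_e0_of_reduced`).  Let `(N₀, D₀)` be a relatively prime pair of real polynomials on `ℝ⁴` with `D₀` of full
degree in `p₀` and with the axis-Stieltjes structure of `N₀/D₀` over every non-zero spatial momentum.  Then `D₀` is Wick-hyperbolic
along `e₀`: on every complex line `z ↦ z e₀ + q`, `q ⊥ e₀` real, all zeros of `D₀` are purely imaginary.

Proof.  Bezout over the spatial function field (`bezoutOverSpatialField`, p669441): `A N₀ + B D₀ = R(q)` with `R ≠ 0`.  For GOOD `q`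
(`q ≠ 0`, `R(q) ≠ 0`) a root `z` of `D₀(·, q)` with `Re z ≠ 0` would, by the cleared-denominator Stieltjes identity
`N₀(t,q)·∏(t²+ω²) = D₀(t,q)·P_q(t)` (a real polynomial identity, hence valid at complex `t`), be a root of `N₀(·, q)` as well
(`z² + ω² ≠ 0` off the imaginary axis), forcing `R(q) = 0`.  ALL `q` by density of the good set (`dense_setOf_eval_ne_zero`, p669358)
and `rootsInClosedSetLimit` (p666193): the fibre polynomials have the constant degree `deg D₀` (full degree) and polynomial coefficients.

Mathlib + tree helpers only; THEOREMS ONLY; no named facts; no `sorry`; default heartbeats.  Nothing about the crux 23124, the route's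
rung or the Yang–Mills mass gap is proved here.  Free-hands seat `ym-line-frs-p2` g10, `--supports stmt-QuantumFields-23124`.
-/

set_option autoImplicit false

namespace Summit.QuantumFields.YangMills.Theorems.RationalShortRootRigidity

open Filter Topology Polynomial
open scoped BigOperators Polynomial

/-- Complex evaluation on the fibre over a real spatial momentum `q`: `P(z, q)` is the value at `z` of the (complexified) fibre
polynomial `t ↦ P(t, q)`. -/
theorem aeval_cons_eq_eval_fibre (P : MvPolynomial (Fin 4) ℝ) (q : Fin 3 → ℝ) (z : ℂ) :
    MvPolynomial.aeval (Fin.cons z (fun i => (q i : ℂ)) : Fin 4 → ℂ) P =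
      (((MvPolynomial.finSuccEquiv ℝ 3 P).map (MvPolynomial.eval q)).map (algebraMap ℝ ℂ)).eval z := by
  induction P using MvPolynomial.induction_on with
  | C a =>
    rw [MvPolynomial.algHom_C, ← MvPolynomial.algebraMap_eq, AlgEquiv.commutes, Polynomial.algebraMap_apply,
      Polynomial.map_C, Polynomial.map_C, eval_C, MvPolynomial.algebraMap_eq, MvPolynomial.eval_C]
  | add p q hp hq => rw [map_add, hp, hq, map_add, Polynomial.map_add, Polynomial.map_add, eval_add]
  | mul_X p i hp =>
    rw [map_mul, hp, map_mul, Polynomial.map_mul, Polynomial.map_mul, eval_mul, MvPolynomial.aeval_X]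
    congr 1
    refine Fin.cases ?_ (fun j => ?_) i
    · rw [Fin.cons_zero, MvPolynomial.finSuccEquiv_X_zero, Polynomial.map_X, Polynomial.map_X, eval_X]
    · rw [Fin.cons_succ, MvPolynomial.finSuccEquiv_X_succ, Polynomial.map_C, MvPolynomial.eval_X, Polynomial.map_C, eval_C]
      rfl

/-- `z² + ω² ≠ 0` for real `ω` when `Re z ≠ 0`. -/
theorem sq_add_sq_ne_zero_of_re_ne_zero (z : ℂ) (ω : ℝ) (hz : z.re ≠ 0) : z ^ 2 + ((ω : ℂ)) ^ 2 ≠ 0 := by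
  intro h
  have hre := congrArg Complex.re h
  have him := congrArg Complex.im h
  simp only [Complex.add_re, Complex.add_im, sq, Complex.mul_re, Complex.mul_im, Complex.ofReal_re, Complex.ofReal_im,
    Complex.zero_re, Complex.zero_im, mul_zero, zero_mul, sub_zero, add_zero] at hre him
  have him0 : z.im = 0 := by
    have : 2 * z.re * z.im = 0 := by linarith
    rcases mul_eq_zero.1 this with h1 | h1
    · exact absurd (by linarith : z.re = 0) hz
    · exact h1
  rw [him0, mul_zero, sub_zero] at hre
  nlinarith [sq_nonneg ω, mul_pos_iff.2 (Or.inl ⟨lt_of_le_of_ne (mul_self_nonneg z.re) (Ne.symm (mul_self_ne_zero.2 hz)),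
    lt_of_le_of_ne (mul_self_nonneg z.re) (Ne.symm (mul_self_ne_zero.2 hz))⟩)]

/-- **Wick-hyperbolicity along `e₀` of a reduced axis-Stieltjes pair** (STUB-PLAN-Reduce §6; `FullDeg`, `AxisStieltjes`, `WickAlong e0`
unfolded as in the crux text). [folklore] -/
theorem wickAlong_e0_of_reduced (N₀ D₀ : MvPolynomial (Fin 4) ℝ) (hcop : IsRelPrime N₀ D₀)
    (hfull : MvPolynomial.coeff (Finsupp.single 0 D₀.totalDegree) D₀ ≠ 0)
    (hAS : ∀ q : Fin 3 → ℝ, q ≠ 0 → ∃ (k : ℕ) (ω r : Fin k → ℝ) (c : Polynomial ℝ),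
        (∀ j, 0 < ω j) ∧ (∀ j, 0 ≤ r j) ∧
        ∀ t : ℝ, MvPolynomial.eval (Fin.cons t q) N₀ =
          MvPolynomial.eval (Fin.cons t q) D₀ * (c.eval (t ^ 2) + ∑ j, r j / (t ^ 2 + ω j ^ 2))) :
    ∀ q : Fin 4 → ℝ, (∑ i, q i * (fun i : Fin 4 => if i = 0 then (1 : ℝ) else 0) i) = 0 →
      ∀ z : ℂ, MvPolynomial.aeval (fun i => z * ((fun i : Fin 4 => if i = 0 then (1 : ℝ) else 0) i : ℂ) + (q i : ℂ)) D₀ = 0 →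
        z.re = 0 := by
  classical
  set d := D₀.totalDegree with hd
  have hD0 : D₀ ≠ 0 := fun h => hfull (by rw [h, MvPolynomial.coeff_zero])
  obtain ⟨A, B, R, hR0, hbez⟩ := bezoutOverSpatialField N₀ D₀ hcop hD0
  have hinj : Function.Injective (algebraMap ℝ ℂ) := (algebraMap ℝ ℂ).injective
  -- the complexified fibre polynomials of `D₀`
  set φ : (Fin 3 → ℝ) → ℂ[X] := fun x =>
    ((MvPolynomial.finSuccEquiv ℝ 3 D₀).map (MvPolynomial.eval x)).map (algebraMap ℝ ℂ) with hφ
  have hφeval : ∀ (x : Fin 3 → ℝ) (w : ℂ),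
      (φ x).eval w = MvPolynomial.aeval (Fin.cons w (fun i => (x i : ℂ)) : Fin 4 → ℂ) D₀ := by
    intro x w; rw [hφ, aeval_cons_eq_eval_fibre]
  have hφdeg : ∀ x, (φ x).natDegree = d := by
    intro x
    rw [hφ]; simp only []
    rw [natDegree_map_eq_of_injective hinj]
    refine le_antisymm ?_ (le_natDegree_of_ne_zero (by rw [coeff_fibre_top D₀ d le_rfl x]; exact hfull))
    refine (natDegree_map_le).trans ?_
    rw [MvPolynomial.natDegree_finSuccEquiv]
    exact MvPolynomial.degreeOf_le_totalDegree D₀ 0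
  have hφ0 : ∀ x, φ x ≠ 0 := by
    intro x h
    have h1 := coeff_fibre_top D₀ d le_rfl x
    have h2 : (MvPolynomial.finSuccEquiv ℝ 3 D₀).map (MvPolynomial.eval x) = 0 := by
      rw [hφ] at h; exact (Polynomial.map_eq_zero_iff hinj).1 h
    rw [h2, coeff_zero] at h1
    exact hfull h1.symm
  have hS : IsClosed {w : ℂ | w.re = 0} := isClosed_eq Complex.continuous_re continuous_const
  -- (i) GOOD spatial momenta
  have hgood : ∀ x : Fin 3 → ℝ, x ≠ 0 → MvPolynomial.eval x R ≠ 0 → ∀ w : ℂ, (φ x).IsRoot w → w ∈ {w : ℂ | w.re = 0} := by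
    intro x hx hRx w hw
    rw [Set.mem_setOf_eq]
    by_contra hre
    obtain ⟨k, ω, r, c, hω, _, hid⟩ := hAS x hx
    -- the cleared-denominator identity, as REAL polynomials in `t`
    obtain ⟨Pi, hPi⟩ : ∃ Pi : ℝ[X], Pi = ∏ j, (X ^ 2 + Polynomial.C (ω j ^ 2)) := ⟨_, rfl⟩
    obtain ⟨Pj, hPj⟩ : ∃ Pj : Fin k → ℝ[X], Pj = fun j => ∏ l ∈ Finset.univ.erase j, (X ^ 2 + Polynomial.C (ω l ^ 2)) :=
      ⟨_, rfl⟩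
    obtain ⟨ψN, hψN⟩ : ∃ ψN : ℝ[X], ψN = (MvPolynomial.finSuccEquiv ℝ 3 N₀).map (MvPolynomial.eval x) := ⟨_, rfl⟩
    obtain ⟨ψD, hψD⟩ : ∃ ψD : ℝ[X], ψD = (MvPolynomial.finSuccEquiv ℝ 3 D₀).map (MvPolynomial.eval x) := ⟨_, rfl⟩
    have hfac : ∀ (t : ℝ) (j : Fin k), Pi.eval t = (t ^ 2 + ω j ^ 2) * (Pj j).eval t := by
      intro t j
      rw [hPi, hPj, ← Finset.mul_prod_erase Finset.univ (fun l => (X ^ 2 + Polynomial.C (ω l ^ 2) : ℝ[X])) (Finset.mem_univ j),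
        eval_mul, eval_add, eval_pow, eval_X, eval_C]
    have hpos : ∀ (t : ℝ) (j : Fin k), t ^ 2 + ω j ^ 2 ≠ 0 := fun t j =>
      (add_pos_of_nonneg_of_pos (sq_nonneg t) (pow_pos (hω j) 2)).ne'
    have hreal : ψN * Pi = ψD * (c.comp (X ^ 2) * Pi + ∑ j, Polynomial.C (r j) * Pj j) := by
      apply Polynomial.funext
      intro t
      have hN : ψN.eval t = MvPolynomial.eval (Fin.cons t x) N₀ := by rw [hψN, MvPolynomial.eval_eq_eval_mv_eval']
      have hD : ψD.eval t = MvPolynomial.eval (Fin.cons t x) D₀ := by rw [hψD, MvPolynomial.eval_eq_eval_mv_eval']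
      rw [eval_mul, eval_mul, eval_add, eval_mul, eval_finsetSum, eval_comp, eval_pow, eval_X, hN, hD, hid t, mul_assoc]
      congr 1
      rw [add_mul, Finset.sum_mul]
      congr 1
      refine Finset.sum_congr rfl fun j _ => ?_
      rw [eval_mul, eval_C, hfac t j]
      have h0 := hpos t j
      field_simp
    -- complexify and evaluate at the root `w`
    have hcx := congrArg (fun F : ℝ[X] => (F.map (algebraMap ℝ ℂ)).eval w) hreal
    simp only [Polynomial.map_mul, eval_mul] at hcx
    have hDw : (ψD.map (algebraMap ℝ ℂ)).eval w = 0 := by rw [hψD]; exact hw.eq_zero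
    rw [hDw, zero_mul] at hcx
    have hPiw : (Pi.map (algebraMap ℝ ℂ)).eval w ≠ 0 := by
      rw [hPi, Polynomial.map_prod, eval_prod]
      refine Finset.prod_ne_zero_iff.2 fun j _ => ?_
      rw [Polynomial.map_add, Polynomial.map_pow, Polynomial.map_X, Polynomial.map_C, eval_add, eval_pow, eval_X, eval_C,
        Complex.coe_algebraMap, Complex.ofReal_pow]
      exact sq_add_sq_ne_zero_of_re_ne_zero w (ω j) hre
    have hNw : (ψN.map (algebraMap ℝ ℂ)).eval w = 0 := (mul_eq_zero.1 hcx).resolve_right hPiw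
    -- Bezout at the common complex zero `(w, x)`
    have hNa : MvPolynomial.aeval (Fin.cons w (fun i => (x i : ℂ)) : Fin 4 → ℂ) N₀ = 0 := by
      rw [aeval_cons_eq_eval_fibre, ← hψN]; exact hNw
    have hDa : MvPolynomial.aeval (Fin.cons w (fun i => (x i : ℂ)) : Fin 4 → ℂ) D₀ = 0 := by
      rw [← hφeval]; exact hw.eq_zero
    have hb := congrArg (MvPolynomial.aeval (Fin.cons w (fun i => (x i : ℂ)) : Fin 4 → ℂ)) hbez
    rw [map_add, map_mul, map_mul, hNa, hDa, mul_zero, mul_zero, add_zero, MvPolynomial.aeval_rename] at hb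
    have hcomp : ((Fin.cons w (fun i => (x i : ℂ)) : Fin 4 → ℂ) ∘ Fin.succ) = (algebraMap ℝ ℂ) ∘ x := by
      funext i; simp only [Function.comp_apply, Fin.cons_succ, Complex.coe_algebraMap]
    rw [hcomp, MvPolynomial.aeval_algebraMap_apply] at hb
    have hb' : ((MvPolynomial.eval x R : ℝ) : ℂ) = 0 := by
      rw [← MvPolynomial.coe_aeval_eq_eval, ← Complex.coe_algebraMap]; exact hb.symm
    exact hRx (Complex.ofReal_eq_zero.1 hb')
  -- (ii) ALL spatial momenta, by density of the good set and closedness of the root condition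
  intro q hq z hz
  have hq0 : q 0 = 0 := by simpa [Fin.sum_univ_four] using hq
  obtain ⟨x, hx⟩ : ∃ x : Fin 3 → ℝ, x = fun i => q (Fin.succ i) := ⟨_, rfl⟩
  have hpt : (fun i : Fin 4 => z * ((fun i : Fin 4 => if i = 0 then (1 : ℝ) else 0) i : ℂ) + (q i : ℂ)) =
      (Fin.cons z (fun i => (x i : ℂ)) : Fin 4 → ℂ) := by
    funext i
    refine Fin.cases ?_ (fun j => ?_) i
    · simp [hq0]
    · simp [hx, Fin.succ_ne_zero]
  rw [hpt, ← hφeval] at hz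
  have hdense : Dense {y : Fin 3 → ℝ | MvPolynomial.eval y (R * MvPolynomial.X 0) ≠ 0} :=
    dense_setOf_eval_ne_zero _ (mul_ne_zero hR0 (MvPolynomial.X_ne_zero 0))
  obtain ⟨u, hu_mem, hu⟩ := mem_closure_iff_seq_limit.1 (hdense x)
  have hgoodn : ∀ n, u n ≠ 0 ∧ MvPolynomial.eval (u n) R ≠ 0 := by
    intro n
    have h := hu_mem n
    simp only [Set.mem_setOf_eq, map_mul, MvPolynomial.eval_X] at h
    refine ⟨fun h0 => h ?_, fun h0 => h (by rw [h0, zero_mul])⟩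
    rw [h0]; simp
  have hcoef : ∀ i : ℕ, Tendsto (fun n => (φ (u n)).coeff i) atTop (𝓝 ((φ x).coeff i)) := by
    intro i
    have hci : ∀ y : Fin 3 → ℝ, (φ y).coeff i =
        ((MvPolynomial.eval y ((MvPolynomial.finSuccEquiv ℝ 3 D₀).coeff i) : ℝ) : ℂ) := by
      intro y; rw [hφ]; simp only [coeff_map]; rfl
    simp_rw [hci]
    exact ((Complex.continuous_ofReal.comp (MvPolynomial.continuous_eval _)).tendsto x).comp hu
  exact rootsInClosedSetLimit {w : ℂ | w.re = 0} hS d (fun n => φ (u n)) (φ x) (fun n => hφdeg (u n)) (hφdeg x) (hφ0 x)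
    hcoef (fun n => hgood (u n) (hgoodn n).1 (hgoodn n).2) z hz

end Summit.QuantumFields.YangMills.Theorems.RationalShortRootRigidity
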